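import Literature.MathematicalPhysics.QuantumManyBody.JelliumCutoffKernelBounds
import Literature.MathematicalPhysics.QuantumManyBody.JelliumLocalizationFunction
import Mathlib.MeasureTheory.Measure.Lebesgue.VolumeOfBalls
import HarnessLib

/-!
# Lieb–Solovej Corollary 4.3: the particle number in a box cannot be too small

Topic `Literature/MathematicalPhysics/QuantumManyBody` (the charged Bose gas, `JelliumBoseGas.foldyLaw`).
[LiebSolovej2001, Corollary 4.3]: "There exists a constant `C > 0` such that if
`ω(t)⁻¹ρ^{1/3}ℓ > C` then `H^n_ℓ ≥ 0` if `n ≤ Cρℓ³`." Proof (printed): choose `R = ρ^{-1/3}`,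
`r = R/2` in Lemma 4.1, drop the kinetic energy and the (nonnegative) pair repulsion, use
`sup_x ∫w_{r,R}(x,y)dy ≤ 4πR²` and `½∬w_{r,R} ≥ cR²ℓ³`.

The last estimate needs the localization function to equal `1` on a sub-cube ("with the given
choice of `R` and `r` it is easy to see"); we prove it for any `0 ≤ θ` with `θ = 1` on a
coordinate cube of side `s ≥ 4R`, with explicit constants:

* `JelliumBoseGas.cutoffKernel_half_ge` — `V_{R/2,R}(z) ≥ e⁻²/R` for `0 < |z| ≤ R`;
* `JelliumBoseGas.setIntegral_ball_cutoffKernel_ge` — `∫_{B(x,R)} V_{R/2,R}(x-y)dy ≥ (4π/3)e⁻²R²`;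
* `JelliumBoseGas.selfEnergyK_cutoff_ge` — `½∬w_{R/2,R} ≥ ½(s/2)³(4π/3)e⁻²R²`;
* `JelliumBoseGas.boxEnergy_ge_smallN` — for every Neumann trial state,
  `⟨Φ,H^n_ℓΦ⟩ ≥ gρ^{1/3}(c_s ρℓ³ - (½ + 5π)n)` when `ν ≤ ρ^{1/3}`, `4ρ^{-1/3} ≤ sℓ` and
  `θ = χ(·/ℓ)` with `χ = 1` on a cube of side `s` (`c_s = ½(s/2)³(4π/3)e⁻²`);
* `JelliumBoseGas.boxGroundStateEnergy_nonneg_of_smallN` — **Corollary 4.3**: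
  `inf Spec H^n_ℓ ≥ 0` if `(½ + 5π) n ≤ c_s ρ ℓ³`.

## References

* [LiebSolovej2001] E. H. Lieb, J. P. Solovej, Commun. Math. Phys. 217 (2001) 127–163,
  Corollary 4.3 (arXiv:cond-mat/0007425, p. 10).
-/

noncomputable section

open MeasureTheory Set Filter Real Metric
open scoped ENNReal NNReal Topology

namespace Literature.MathematicalPhysics.QuantumManyBody.JelliumBoseGas

open BoseGas Coulomb

variable {n : ℕ} {ℓ : ℝ}

/-! ### The kernel `V_{R/2,R}` near the origin -/

/-- **`V_{R/2,R}(z) ≥ e⁻²/R` for `0 < |z| ≤ R`**: with `u = |z|/R ∈ (0,1]`,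
`V = e^{-u}(1 - e^{-u})/(uR) ≥ e^{-1}·e^{-u}/R ≥ e⁻²/R`. [cite: LiebSolovej2001, Cor. 4.3 (proof)] -/
theorem cutoffKernel_half_ge {R : ℝ} (hR : 0 < R) {z : Space} (hz : z ≠ 0) (hzR : ‖z‖ ≤ R) :
    Real.exp (-2) / R ≤ cutoffKernel (R / 2) R z := by
  have hzn : 0 < ‖z‖ := norm_pos_iff.2 hz
  set u : ℝ := ‖z‖ / R with hu
  have hu0 : 0 < u := div_pos hzn hR
  have hu1 : u ≤ 1 := (div_le_one hR).2 hzR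
  have hzu : ‖z‖ = u * R := by rw [hu, div_mul_cancel₀ _ hR.ne']
  unfold cutoffKernel yukawa
  rw [div_sub_div_same, hzu]
  have e1 : Real.exp (-(R⁻¹ * (u * R))) = Real.exp (-u) := by
    rw [inv_mul_eq_div, mul_div_cancel_right₀ u hR.ne']
  have e2 : Real.exp (-((R / 2)⁻¹ * (u * R))) = Real.exp (-u) * Real.exp (-u) := by
    rw [← Real.exp_add, inv_div, div_mul_eq_mul_div, mul_div_assoc, mul_div_cancel_right₀ u hR.ne']
    ring_nf
  rw [e1, e2, le_div_iff₀ (mul_pos hu0 hR), show Real.exp (-u) - Real.exp (-u) * Real.exp (-u) =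
    Real.exp (-u) * (1 - Real.exp (-u)) by ring]
  have h1 : Real.exp (-1) ≤ Real.exp (-u) := Real.exp_le_exp.2 (by linarith)
  have h2 : u * Real.exp (-u) ≤ 1 - Real.exp (-u) := by
    -- `1 + u ≤ e^u`, multiplied by `e^{-u} > 0`
    have h := Real.add_one_le_exp u
    have hpos := Real.exp_pos (-u)
    have e : Real.exp (-u) * Real.exp u = 1 := by rw [← Real.exp_add]; simp
    nlinarith [mul_le_mul_of_nonneg_left h hpos.le]
  have h3 : u * Real.exp (-1) ≤ u * Real.exp (-u) := mul_le_mul_of_nonneg_left h1 hu0.le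
  have e3 : Real.exp (-2) = Real.exp (-1) * Real.exp (-1) := by rw [← Real.exp_add]; norm_num
  calc Real.exp (-2) / R * (u * R) = u * Real.exp (-1) * Real.exp (-1) := by
        rw [e3]; field_simp
    _ ≤ (1 - Real.exp (-u)) * Real.exp (-u) :=
        mul_le_mul (h3.trans h2) h1 (Real.exp_pos _).le (sub_nonneg.2 (Real.exp_le_one_iff.2 (by linarith)))
    _ = Real.exp (-u) * (1 - Real.exp (-u)) := mul_comm _ _

/-- **`∫_{B(x,R)} V_{R/2,R}(x-y) dy ≥ (4π/3)e⁻²R²`**. [cite: LiebSolovej2001, Cor. 4.3 (proof)] -/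
theorem setIntegral_ball_cutoffKernel_ge {R : ℝ} (hR : 0 < R) (x : Space) :
    4 * π / 3 * Real.exp (-2) * R ^ 2 ≤ ∫ y in ball x R, cutoffKernel (R / 2) R (x - y) := by
  have hr : 0 < R / 2 := by positivity
  have hrR : R / 2 ≤ R := by linarith
  have hVi : IntegrableOn (fun y => cutoffKernel (R / 2) R (x - y)) (ball x R) :=
    ((integrable_cutoffKernel hr hR).comp_sub_left x).integrableOn
  have hvol : (volume (ball x R)).toReal = 4 * π / 3 * R ^ 3 := by
    rw [EuclideanSpace.volume_ball_fin_three, ENNReal.toReal_mul, ENNReal.toReal_pow,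
      ENNReal.toReal_ofReal hR.le, ENNReal.toReal_ofReal (by positivity)]
    ring
  have hae : ∀ᵐ y ∂(volume.restrict (ball x R)), Real.exp (-2) / R ≤ cutoffKernel (R / 2) R (x - y) := by
    have h1 : ∀ᵐ y : Space ∂volume, y ≠ x := compl_mem_ae_iff.2 (measure_singleton x)
    filter_upwards [ae_restrict_of_ae h1, ae_restrict_mem measurableSet_ball] with y hy hyb
    refine cutoffKernel_half_ge hR (sub_ne_zero.2 (Ne.symm hy)) ?_
    rw [← dist_eq_norm, dist_comm]
    exact (mem_ball.1 hyb).le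
  haveI : IsFiniteMeasure (volume.restrict (ball x R)) :=
    ⟨by rw [Measure.restrict_apply_univ]; exact measure_ball_lt_top⟩
  calc 4 * π / 3 * Real.exp (-2) * R ^ 2 = ∫ _ in ball x R, Real.exp (-2) / R := by
        rw [setIntegral_const, smul_eq_mul, measureReal_def, hvol]
        field_simp
    _ ≤ ∫ y in ball x R, cutoffKernel (R / 2) R (x - y) :=
        integral_mono_ae (integrable_const _) hVi hae

/-! ### The background self-energy is at least `c R² |cube|` -/

/-- **`½∬w_{R/2,R} ≥ ½(s/2)³(4π/3)e⁻²R²`** when `0 ≤ θ ≤ 1` is measurable and integrable,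
`θ = 1` on the coordinate cube `[a, a+s]³` and `4R ≤ s`: the points of the shrunk cube
`[a+R, a+s-R]³` see a full ball of radius `R` inside the cube. [cite: LiebSolovej2001, Cor. 4.3 (proof)] -/
theorem selfEnergyK_cutoff_ge {θ : Space → ℝ} (hθm : Measurable θ) (hθi : Integrable θ)
    (hθ0 : ∀ x, 0 ≤ θ x) (hθ1 : ∀ x, θ x ≤ 1) {a s R : ℝ} (hR : 0 < R) (hRs : 4 * R ≤ s)
    (hone : ∀ x : Space, (∀ k, x k ∈ Set.Icc a (a + s)) → θ x = 1) :
    1 / 2 * (s / 2) ^ 3 * (4 * π / 3 * Real.exp (-2) * R ^ 2) ≤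
      selfEnergyK (cutoffKernel (R / 2) R) θ := by
  have hr : 0 < R / 2 := by positivity
  have hrR : R / 2 ≤ R := by linarith
  have hV0 := cutoffKernel_nonneg hr hrR
  have hVm := measurable_cutoffKernel (R / 2) R
  have hVi := integrable_cutoffKernel hr hR
  have hθM : ∀ y, ‖θ y‖ ≤ 1 := fun y => by
    rw [Real.norm_eq_abs, abs_of_nonneg (hθ0 y)]; exact hθ1 y
  set c : ℝ := 4 * π / 3 * Real.exp (-2) * R ^ 2 with hc
  have hc0 : 0 ≤ c := by positivity
  set Q' : Set Space := {x : Space | ∀ k, x k ∈ Set.Icc (a + R) (a + R + (s - 2 * R))} with hQ'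
  have hQ'm : MeasurableSet Q' := measurableSet_coordCube _ _
  have hvolQ'e : volume Q' = ENNReal.ofReal (s - 2 * R) ^ 3 := by
    rw [hQ', volume_coordCube]; ring_nf
  have hvolQ' : (volume Q').toReal = (s - 2 * R) ^ 3 := by
    rw [hvolQ'e, ENNReal.toReal_pow, ENNReal.toReal_ofReal (by linarith)]
  have hvolQ'top : volume Q' ≠ ⊤ := by rw [hvolQ'e]; exact ENNReal.pow_ne_top ENNReal.ofReal_ne_top
  -- the background on the shrunk cube
  have hbg : ∀ x ∈ Q', c ≤ backgroundK (cutoffKernel (R / 2) R) θ x := by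
    intro x hx
    have hθball : ∀ y ∈ ball x R, θ y = 1 := by
      intro y hy
      refine hone y fun k => ?_
      have hk : |y k - x k| ≤ ‖y - x‖ := by
        have h1 : ‖(y - x) k‖ ^ 2 ≤ ∑ i, ‖(y - x) i‖ ^ 2 :=
          Finset.single_le_sum (f := fun i => ‖(y - x) i‖ ^ 2) (fun i _ => sq_nonneg _)
            (Finset.mem_univ k)
        rw [← Real.norm_eq_abs]
        calc ‖y k - x k‖ = Real.sqrt (‖(y - x) k‖ ^ 2) := by
              rw [Real.sqrt_sq (norm_nonneg _)]; rfl
          _ ≤ Real.sqrt (∑ i, ‖(y - x) i‖ ^ 2) := Real.sqrt_le_sqrt h1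
          _ = ‖y - x‖ := (EuclideanSpace.norm_eq (y - x)).symm
      have hd : ‖y - x‖ < R := by rw [← dist_eq_norm]; exact mem_ball.1 hy
      have h1 := abs_le.1 (hk.trans hd.le)
      have hxk := hx k
      exact ⟨by linarith [hxk.1, h1.1], by linarith [hxk.2, h1.2]⟩
    have hint : Integrable fun y : Space => θ y * cutoffKernel (R / 2) R (x - y) :=
      integrable_mul_kernel_sub hθm hθM hVi x
    calc c ≤ ∫ y in ball x R, cutoffKernel (R / 2) R (x - y) := setIntegral_ball_cutoffKernel_ge hR x
      _ = ∫ y in ball x R, θ y * cutoffKernel (R / 2) R (x - y) :=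
          setIntegral_congr_fun measurableSet_ball fun y hy => by rw [hθball y hy, one_mul]
      _ ≤ ∫ y, θ y * cutoffKernel (R / 2) R (x - y) :=
          setIntegral_le_integral hint (Eventually.of_forall fun y => mul_nonneg (hθ0 y) (hV0 _))
  -- integrate over the shrunk cube
  have hbg0 : ∀ x, 0 ≤ backgroundK (cutoffKernel (R / 2) R) θ x := backgroundK_nonneg hV0 hθ0
  have hθQ' : ∀ x ∈ Q', θ x = 1 := by
    intro x hx
    refine hone x fun k => ?_
    have := hx k
    exact ⟨by linarith [this.1], by linarith [this.2, hR.le]⟩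
  have hbgm : Measurable (backgroundK (cutoffKernel (R / 2) R) θ) := measurable_backgroundK hVm hθm
  have hbgb : ∀ x, backgroundK (cutoffKernel (R / 2) R) θ x ≤ ∫ y, cutoffKernel (R / 2) R y :=
    backgroundK_le hV0 hVi hθ0 hθ1
  have hprod : Integrable fun x : Space => θ x * backgroundK (cutoffKernel (R / 2) R) θ x :=
    integrable_mul_backgroundK hθm hθi hθ0 hθ1 hV0 hVm hVi
  have hbgQ' : IntegrableOn (backgroundK (cutoffKernel (R / 2) R) θ) Q' := by
    refine Measure.integrableOn_of_bounded (M := ∫ y, cutoffKernel (R / 2) R y) hvolQ'top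
      hbgm.aestronglyMeasurable (Eventually.of_forall fun x => ?_)
    rw [Real.norm_eq_abs, abs_of_nonneg (hbg0 x)]
    exact hbgb x
  have hs2 : s / 2 ≤ s - 2 * R := by linarith
  have hs0 : 0 ≤ s / 2 := by linarith
  calc 1 / 2 * (s / 2) ^ 3 * c ≤ 1 / 2 * ((s - 2 * R) ^ 3 * c) := by
        rw [mul_assoc]
        exact mul_le_mul_of_nonneg_left (mul_le_mul_of_nonneg_right
          (pow_le_pow_left₀ hs0 hs2 3) hc0) (by norm_num)
    _ = 1 / 2 * ∫ _ in Q', c := by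
        rw [setIntegral_const, smul_eq_mul, measureReal_def, hvolQ']
    _ ≤ 1 / 2 * ∫ x in Q', backgroundK (cutoffKernel (R / 2) R) θ x := by
        refine mul_le_mul_of_nonneg_left ?_ (by norm_num)
        haveI : IsFiniteMeasure (volume.restrict Q') :=
          ⟨by rw [Measure.restrict_apply_univ]; exact hvolQ'top.lt_top⟩
        exact setIntegral_mono_on (integrable_const c) hbgQ' hQ'm hbg
    _ = 1 / 2 * ∫ x in Q', θ x * backgroundK (cutoffKernel (R / 2) R) θ x := by
        congr 1
        exact setIntegral_congr_fun hQ'm fun x hx => by rw [hθQ' x hx, one_mul]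
    _ ≤ 1 / 2 * ∫ x, θ x * backgroundK (cutoffKernel (R / 2) R) θ x := by
        refine mul_le_mul_of_nonneg_left ?_ (by norm_num)
        exact setIntegral_le_integral hprod (Eventually.of_forall fun x => mul_nonneg (hθ0 x) (hbg0 x))
    _ = selfEnergyK (cutoffKernel (R / 2) R) θ := rfl

/-! ### Corollary 4.3 -/

/-- **[LiebSolovej2001, Cor. 4.3] for the quadratic form, explicit constants**: let
`θ = χ(·/ℓ)` with `χ` measurable and integrable, `0 ≤ χ ≤ 1`, `χ = 1` on a coordinate cube
`[a,a+s]³`; let `κ, g ≥ 0`, `ρ > 0`, `R = ρ^{-1/3}` with `ν ≤ ρ^{1/3}` ("`R ≤ ω(t)⁻¹ℓ`") and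
`4ρ^{-1/3} ≤ sℓ`. Then for every Neumann trial state
`⟨Φ, H^n_ℓ Φ⟩ ≥ g ρ^{1/3} (c_s ρℓ³ - (½ + 5π) n)`, `c_s = ½(s/2)³(4π/3)e⁻²`
(Lemma 4.1 with `r = R/2`, dropping `T ≥ 0` and `∑w ≥ 0`, `∑ⱼ∫w(xⱼ,y)dy ≤ 4πnR²`,
`½ρ²∬w ≥ c_s ρ²R²ℓ³`). [cite: LiebSolovej2001, Cor. 4.3] -/
theorem boxEnergy_ge_smallN {κ g ρ : ℝ} (hκ : 0 ≤ κ) (hg : 0 ≤ g) (hρ : 0 < ρ) {χ : Space → ℝ}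
    (hχm : Measurable χ) (hχi : Integrable χ) (hχ0 : ∀ x, 0 ≤ χ x) (hχ1 : ∀ x, χ x ≤ 1)
    {a s : ℝ} (hone : ∀ x : Space, (∀ k, x k ∈ Set.Icc a (a + s)) → χ x = 1)
    (hℓ : 0 < ℓ) (hsℓ : 4 * ρ ^ (-(1 / 3 : ℝ)) ≤ s * ℓ) {ν : ℝ} (hν : 0 < ν)
    (hνρ : ν ≤ ρ ^ (1 / 3 : ℝ)) (Φ : NeumannTrialState n ℓ) :
    g * ρ ^ (1 / 3 : ℝ) * (1 / 2 * (s / 2) ^ 3 * (4 * π / 3 * Real.exp (-2)) * (ρ * ℓ ^ 3) -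
        (1 / 2 + 5 * π) * n) ≤ boxEnergy κ g ρ (fun x => χ (ℓ⁻¹ • x)) ν Φ := by
  set R : ℝ := ρ ^ (-(1 / 3 : ℝ)) with hRdef
  have hR : 0 < R := Real.rpow_pos_of_pos hρ _
  have hRinv : R⁻¹ = ρ ^ (1 / 3 : ℝ) := by rw [hRdef, Real.rpow_neg hρ.le, inv_inv]
  have hρR2 : ρ * R ^ 2 = ρ ^ (1 / 3 : ℝ) := by
    rw [hRdef, ← Real.rpow_natCast (ρ ^ (-(1 / 3 : ℝ))) 2, ← Real.rpow_mul hρ.le]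
    conv_lhs => rw [← Real.rpow_one ρ]
    rw [← Real.rpow_mul hρ.le, ← Real.rpow_add hρ]
    norm_num
  have hρ2R2 : ρ ^ 2 * R ^ 2 = ρ ^ (1 / 3 : ℝ) * ρ := by
    rw [← hρR2]; ring
  have hr : 0 < R / 2 := by positivity
  have hrR : R / 2 ≤ R := by linarith
  -- the scaled cutoff
  have hθm : Measurable fun x : Space => χ (ℓ⁻¹ • x) := hχm.comp (measurable_const_smul _)
  have hθi : Integrable fun x : Space => χ (ℓ⁻¹ • x) := hχi.comp_smul (inv_ne_zero hℓ.ne')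
  have hθ0 : ∀ x : Space, 0 ≤ χ (ℓ⁻¹ • x) := fun x => hχ0 _
  have hθ1 : ∀ x : Space, χ (ℓ⁻¹ • x) ≤ 1 := fun x => hχ1 _
  have honeℓ : ∀ x : Space, (∀ k, x k ∈ Set.Icc (a * ℓ) (a * ℓ + s * ℓ)) → χ (ℓ⁻¹ • x) = 1 := by
    intro x hx
    refine hone _ fun k => ?_
    have hk := hx k
    have e : (ℓ⁻¹ • x) k = ℓ⁻¹ * x k := rfl
    rw [e]
    constructor
    · rw [le_inv_mul_iff₀ hℓ]; linarith [hk.1]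
    · rw [inv_mul_le_iff₀ hℓ]; linarith [hk.2]
  -- Lemma 4.1 with `r = R/2`
  have h41 := boxEnergyK_cutoff_le (κ := κ) hg hρ.le hθm hθi hθ0 hθ1 hν (by rwa [hRinv]) hr hrR Φ
  -- lower bound on the cut-off functional
  have hse := selfEnergyK_cutoff_ge hθm hθi hθ0 hθ1 (a := a * ℓ) hR (by linarith) honeℓ
  have hV0 := cutoffKernel_nonneg hr hrR
  have hVi := integrable_cutoffKernel hr hR
  have hPB : (oneBodyExpectationK (cutoffKernel (R / 2) R) (fun x => χ (ℓ⁻¹ • x)) Φ).toReal ≤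
      n * (4 * π * R ^ 2) := by
    have h := ENNReal.toReal_mono ENNReal.ofReal_ne_top
      (oneBodyExpectationK_le hV0 hVi hθ0 hθ1 Φ)
    rw [ENNReal.toReal_ofReal (mul_nonneg (Nat.cast_nonneg _) (integral_nonneg hV0))] at h
    refine h.trans (mul_le_mul_of_nonneg_left ?_ (Nat.cast_nonneg _))
    rw [integral_cutoffKernel hr hR]
    nlinarith [Real.pi_pos, sq_nonneg R]
  have hT : 0 ≤ (boxKinetic Φ).toReal := ENNReal.toReal_nonneg
  have hPP : 0 ≤ (pairExpectationK (cutoffKernel (R / 2) R) (fun x => χ (ℓ⁻¹ • x)) Φ).toReal :=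
    ENNReal.toReal_nonneg
  have hK : g * (-(ρ * (n * (4 * π * R ^ 2))) + ρ ^ 2 * (1 / 2 * (s * ℓ / 2) ^ 3 *
      (4 * π / 3 * Real.exp (-2) * R ^ 2))) ≤
      boxEnergyK κ g ρ (cutoffKernel (R / 2) R) (fun x => χ (ℓ⁻¹ • x)) Φ := by
    unfold boxEnergyK
    nlinarith [mul_nonneg hκ hT, mul_nonneg hg hPP, mul_le_mul_of_nonneg_left hPB (mul_nonneg hg hρ.le),
      mul_le_mul_of_nonneg_left hse (mul_nonneg hg (sq_nonneg ρ))]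
  -- arithmetic
  have e1 : (s * ℓ / 2) ^ 3 = (s / 2) ^ 3 * ℓ ^ 3 := by ring
  rw [e1] at hK
  have e2 : g * ρ ^ (1 / 3 : ℝ) * (1 / 2 * (s / 2) ^ 3 * (4 * π / 3 * Real.exp (-2)) * (ρ * ℓ ^ 3) -
      (1 / 2 + 5 * π) * n) =
      g * (-(ρ * (n * (4 * π * R ^ 2))) + ρ ^ 2 * (1 / 2 * ((s / 2) ^ 3 * ℓ ^ 3) *
        (4 * π / 3 * Real.exp (-2) * R ^ 2))) - g * (n * (1 / 2 * R⁻¹ + 4 * π * ρ * (R / 2) ^ 2)) := by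
    rw [hRinv]
    have e3 : 4 * π * ρ * (R / 2) ^ 2 = π * ρ ^ (1 / 3 : ℝ) := by rw [← hρR2]; ring
    have e4 : ρ * (n * (4 * π * R ^ 2)) = 4 * π * n * ρ ^ (1 / 3 : ℝ) := by rw [← hρR2]; ring
    have e5 : ρ ^ 2 * (1 / 2 * ((s / 2) ^ 3 * ℓ ^ 3) * (4 * π / 3 * Real.exp (-2) * R ^ 2)) =
        ρ ^ (1 / 3 : ℝ) * ρ * (1 / 2 * ((s / 2) ^ 3 * ℓ ^ 3) * (4 * π / 3 * Real.exp (-2))) := by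
      rw [← hρ2R2]; ring
    rw [e3, e4, e5]
    ring
  rw [e2]
  linarith

/-- **[LiebSolovej2001, Corollary 4.3] (the particle number cannot be too small)**: with the
notation and hypotheses of `boxEnergy_ge_smallN` and `ℓ > 0`, if
`(½ + 5π) n ≤ c_s ρ ℓ³` then `inf Spec H^n_ℓ ≥ 0`. [cite: LiebSolovej2001, Cor. 4.3] -/
theorem boxGroundStateEnergy_nonneg_of_smallN {κ g ρ : ℝ} (hκ : 0 ≤ κ) (hg : 0 ≤ g) (hρ : 0 < ρ)
    {χ : Space → ℝ} (hχm : Measurable χ) (hχi : Integrable χ) (hχ0 : ∀ x, 0 ≤ χ x)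
    (hχ1 : ∀ x, χ x ≤ 1) {a s : ℝ} (hone : ∀ x : Space, (∀ k, x k ∈ Set.Icc a (a + s)) → χ x = 1)
    (hℓ : 0 < ℓ) (hsℓ : 4 * ρ ^ (-(1 / 3 : ℝ)) ≤ s * ℓ) {ν : ℝ} (hν : 0 < ν)
    (hνρ : ν ≤ ρ ^ (1 / 3 : ℝ))
    (hn : (1 / 2 + 5 * π) * n ≤ 1 / 2 * (s / 2) ^ 3 * (4 * π / 3 * Real.exp (-2)) * (ρ * ℓ ^ 3)) :
    0 ≤ boxGroundStateEnergy κ g ρ (fun x => χ (ℓ⁻¹ • x)) ν n ℓ := by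
  refine le_boxGroundStateEnergy hℓ fun Φ _ => ?_
  have h := boxEnergy_ge_smallN hκ hg hρ hχm hχi hχ0 hχ1 hone hℓ hsℓ hν hνρ Φ
  have h0 : 0 ≤ g * ρ ^ (1 / 3 : ℝ) * (1 / 2 * (s / 2) ^ 3 * (4 * π / 3 * Real.exp (-2)) * (ρ * ℓ ^ 3) -
      (1 / 2 + 5 * π) * n) :=
    mul_nonneg (mul_nonneg hg (Real.rpow_nonneg hρ.le _)) (by linarith)
  linarith

end Literature.MathematicalPhysics.QuantumManyBody.JelliumBoseGas
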